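import Literature.AnabelianGeometry.EtaleTheta.DivisorMonoidsCuspidal
import Literature.AlgebraicGeometry.Frobenioids.PerfFactorialWeakFinite
import Literature.AlgebraicGeometry.Frobenioids.PerfectionDivisorial

/-!
# [EtTh] Definition 3.1 (i) / 3.3 (iii): the support characterisation of (non-)cuspidal log-divisors in
# `Φ₀(Y)` for WEAKLY perf-factorial `Φ₀(Y)`

Mochizuki, *The étale theta function …*, Publ. RIMS **45** (2009), Def. 3.1 (i), PDF p.70 (printed 296)
[cite: MochizukiEtTh2009, Def 3.1 p.70]; Def. 3.3 (iii) p.73; Prop. 3.4 (i) p.74 ("`Φ₀(Y^log)` … is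
perf-factorial").  Weak-hypothesis twin of the last block of `DivisorMonoidsCuspidal.lean` (same seat):
there, the two SUPPORT CHARACTERISATIONS `x ∈ ncsp₀ ⟺ every primary y ≼ x is in ncsp₀` (and for
`csp₀`) carry `IsPerfFactorial (Φ₀ Y)` — unsatisfiable at tempered coverings with infinitely many
special-fibre components (`Ÿ`, `Z_∞`; finding F-L2d2-1 of the abc-iut cell).  What the proofs use of
[FrdI] Def. 2.4 (i) is clause (c) ONLY (the factorization of `c ≠ 0` is nonzero at some prime `𝔮`, and
then some primary element of class `𝔮` divides a power of `c`) — so they go through for the cell's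
WEAK notion `IsPerfFactorialWeak` (`PerfFactorialWeak.lean`; sup calculus `PerfFactorialWeakFinite.lean`):

* `IsPerfFactorialWeak.exists_factorMap_apply_ne_one`, `.exists_isPrimary_precsim_of_factorMap_ne_one`,
  `.exists_isPrimary_precsim` ([FrdI] Def. 2.4 (i)(c) for weak `M`);
* `DivisorMonoids.mem_ncsp₀_iff_forall_isPrimary_weak`, `mem_csp₀_iff_forall_isPrimary_weak`
  (`hpf : IsPerfFactorialWeak (Φ₀ Y)`) — the `Φ₀`-level inputs of Cor. 3.8 (iii) over the weak
  realified data `ofRlfZWeak` (abc-iut-L6-t12).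

Theorems only.  Seat abc-iut-L2-d2 (cell abc-iut, F-L2d2-1 / F-L2d2-2 repair chain).  HONEST FRAMING:
refereed pre-IUT material; nothing here bears on [IUTchIII] Cor. 3.12.
-/

namespace Literature.AlgebraicGeometry.Frobenioids

open Function

universe u

/-- A non-zero element of `M^pf` has a non-zero factorization, for WEAKLY perf-factorial `M` (clause (c):
the factorization homomorphism is injective). [cite: MochizukiFrdI2008, Def. 2.4(i) p.47] -/
theorem IsPerfFactorialWeak.exists_factorMap_apply_ne_one {M : Type u} [CommMonoid M]
    (h : IsPerfFactorialWeak M) {y : Perfection M} (hy : y ≠ 1) :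
    ∃ 𝔮 : Primes (Perfection M), factorMap M y 𝔮 ≠ 1 := by
  by_contra hc
  push Not at hc
  exact hy (h.factorMap_injective ((funext hc).trans h.factorMap_one.symm))

/-- **The prime-targeted form of [FrdI] Def. 2.4 (i)(c), weak hypothesis**: if the factorization of
`c ∈ M` is nonzero at the prime `𝔮` of `M^pf`, then some primary `m ∈ M` whose image lies in `𝔮`
satisfies `m ≼ c`. [cite: MochizukiFrdI2008, Def. 2.4(i) p.47] -/
theorem IsPerfFactorialWeak.exists_isPrimary_precsim_of_factorMap_ne_one {M : Type u} [CommMonoid M]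
    (h : IsPerfFactorialWeak M) {c : M} {𝔮 : Primes (Perfection M)}
    (h𝔮 : factorMap M (Perfection.of M c) 𝔮 ≠ 1) :
    ∃ m : M, IsPrimary m ∧ Perfection.of M m ∈ 𝔮.carrier ∧ Precsim m c := by
  have hM : IsSharp M := h.isDivisorial.isSharp
  have hMpf : IsSharp (Perfection M) := h.isDivisorial.perfection.isSharp
  -- some element of `𝔮` divides `c` in `M^pf`
  have hx : ∃ x : PfAt M 𝔮, x.1 ∈ 𝔮.carrier ∧ x.1 ∣ Perfection.of M c := by
    by_contra hne
    push Not at hne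
    apply h𝔮
    have hb : IsBoundedBy (boundAt M 𝔮 (Perfection.of M c)) 1 := by
      rintro y ⟨x, hx𝔮, hxc, rfl⟩
      rcases hx𝔮 with hx𝔮 | hx1
      · exact absurd hxc (hne x hx𝔮)
      · have : x = 1 := Subtype.ext hx1
        rw [this, map_one]
    have h1 := h.factorMap_dvd_of_isBoundedBy hb
    exact (Literature.AnabelianGeometry.EtaleTheta.MonoprimeStructure.isSharp
      (IsMonoprime.ofR (h.isRMonoprime_rlfAt 𝔮))).eq_one_of_isUnit _ (isUnit_of_dvd_one h1)
  obtain ⟨x, hxp, hxc⟩ := hx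
  obtain ⟨⟨m, k⟩, hmk⟩ := Perfection.mk_surjective x.1
  dsimp only at hmk
  have hpow : x.1 ^ (k : ℕ) = Perfection.of M m := by rw [← hmk, Perfection.mk_pow_self]
  refine ⟨m, (Perfection.isPrimary_of_iff hM).1 (hpow ▸ (hxp.1.pow hMpf k.pos)),
    hpow ▸ Primes.pow_mem_carrier hMpf 𝔮 hxp k.pos, ?_⟩
  rw [← Perfection.of_precsim_of_iff, ← hpow]
  exact ⟨k, k.pos, pow_dvd_pow_of_dvd hxc _⟩

/-- **In a WEAKLY perf-factorial monoid every `c ≠ 0` satisfies `m ≼ c` for some primary `m`** ([FrdI]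
Def. 2.4 (i)(c)). [cite: MochizukiFrdI2008, Def. 2.4(i) p.47] -/
theorem IsPerfFactorialWeak.exists_isPrimary_precsim {M : Type u} [CommMonoid M]
    (h : IsPerfFactorialWeak M) {c : M} (hc : c ≠ 1) : ∃ m : M, IsPrimary m ∧ Precsim m c := by
  have hoc : Perfection.of M c ≠ 1 := by
    rw [Perfection.of_apply]
    exact fun e => hc ((Perfection.mk_eq_one_iff_of_isSharp h.isDivisorial.isSharp).1 e)
  obtain ⟨𝔮, h𝔮⟩ := h.exists_factorMap_apply_ne_one hoc
  obtain ⟨m, hm, -, hmc⟩ := h.exists_isPrimary_precsim_of_factorMap_ne_one h𝔮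
  exact ⟨m, hm, hmc⟩

end Literature.AlgebraicGeometry.Frobenioids

namespace Literature.AnabelianGeometry.EtaleTheta

namespace DivisorMonoids

open CategoryTheory Opposite Literature.AlgebraicGeometry.Frobenioids

universe u v w

/-- **Support characterisation of the non-cuspidal log-divisors, weak hypothesis** (`Φ₀(Y)` WEAKLY
perf-factorial — Prop 3.4 (i) read in the repaired vocabulary): `x` is non-cuspidal iff every primary
`y ≼ x` is (support in the special fibre, Def 3.1 (i)). [cite: MochizukiEtTh2009, Def 3.1 p.70] -/
theorem mem_ncsp₀_iff_forall_isPrimary_weak {D₀ : Type u} [Category.{v} D₀]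
    (T : DivisorMonoids.{u, v, w} D₀) (Y : D₀ᵒᵖ) (hpf : IsPerfFactorialWeak (T.Φ₀.obj Y))
    (x : T.Φ₀.obj Y) :
    x ∈ T.ncsp₀ Y ↔ ∀ y : T.Φ₀.obj Y, IsPrimary y → Precsim y x → y ∈ T.ncsp₀ Y := by
  have hS := hpf.isDivisorial.isSharp
  refine ⟨fun hx y _ hyx => T.mem_ncsp₀_of_precsim Y hS hyx hx, fun H => ?_⟩
  obtain ⟨⟨a, c⟩, hac, -⟩ := T.existsUnique_ncsp_csp Y x
  by_cases hc : (c : T.Φ₀.obj Y) = 1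
  · rw [← hac, hc, mul_one]
    exact a.2
  · obtain ⟨m, hm, hmc⟩ := hpf.exists_isPrimary_precsim hc
    have hmx : Precsim m x := hmc.trans (Precsim.of_dvd ⟨a, by rw [← hac, mul_comm]⟩)
    exact absurd (T.eq_one_of_mem_ncsp₀_of_mem_csp₀ Y (H m hm hmx) (T.mem_csp₀_of_precsim Y hS hmc c.2))
      hm.1

/-- **Support characterisation of the cuspidal log-divisors, weak hypothesis** (`Φ₀(Y)` WEAKLY
perf-factorial): `x` is cuspidal iff every primary `y ≼ x` is (support in the divisor of cusps,
Def 3.1 (i)). [cite: MochizukiEtTh2009, Def 3.1 p.70] -/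
theorem mem_csp₀_iff_forall_isPrimary_weak {D₀ : Type u} [Category.{v} D₀]
    (T : DivisorMonoids.{u, v, w} D₀) (Y : D₀ᵒᵖ) (hpf : IsPerfFactorialWeak (T.Φ₀.obj Y))
    (x : T.Φ₀.obj Y) :
    x ∈ T.csp₀ Y ↔ ∀ y : T.Φ₀.obj Y, IsPrimary y → Precsim y x → y ∈ T.csp₀ Y := by
  have hS := hpf.isDivisorial.isSharp
  refine ⟨fun hx y _ hyx => T.mem_csp₀_of_precsim Y hS hyx hx, fun H => ?_⟩
  obtain ⟨⟨a, c⟩, hac, -⟩ := T.existsUnique_ncsp_csp Y x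
  by_cases ha : (a : T.Φ₀.obj Y) = 1
  · rw [← hac, ha, one_mul]
    exact c.2
  · obtain ⟨m, hm, hma⟩ := hpf.exists_isPrimary_precsim ha
    have hmx : Precsim m x := hma.trans (Precsim.of_dvd ⟨c, hac.symm⟩)
    exact absurd (T.eq_one_of_mem_ncsp₀_of_mem_csp₀ Y (T.mem_ncsp₀_of_precsim Y hS hma a.2) (H m hm hmx))
      hm.1

end DivisorMonoids

end Literature.AnabelianGeometry.EtaleTheta
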